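import Mathlib
import Summits.Ventures.PercRepro2.TB14DomZ

/-!
# Row 2′TB: the release Hall of record reduces to its MARK-FREE form
(blind cell PercRepro2, mine-c g22, 2026-08-26; `conjectures/MINE-C.md` §31)

The Prop of record `TB14DomZ.DomZRelease` asks Hall's condition for the release moves of the
sources `{Q, b ∈ C_red(a₁), o ∈ C_red(a₂) ∖ C_blue(a₂)}` for EVERY mark `b`.  The census codes of
the seat (and the engine's twins) compute the MARK-FREE condition — the sources `{Q, o ∈ A}` with no
mark, which is the case `b = a₁`.  This file shows the two are the same statement:

* `conn_a1_of_release`: a release move keeps every red connection from `a₁` — under `Q` the red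
  cluster of `a₁` lies outside the red cluster `T` of `a₂`, the released part `Z ⊆ T`, and the move
  recolours only edges touching `Z`; so `b ∈ C_red(a₁)` is inherited by the target;
* `releaseHallAt_of_free`: Hall for the mark-free sources gives Hall for the sources of every `b`
  (a perfect matching of the mark-free sources, restricted to the sources with `b ∈ C_red(a₁)`,
  lands in targets with `b ∈ C_red(a₁)`);
* `DomZReleaseFree` (the mark-free Prop), `DomZRelease_of_free`, `TB14_of_DomZReleaseFree`.

So the census bars of the mark-free release Hall (n = 5 all, n = 6 all m ≤ 15, n = 7 all m ≤ 9,
3,543 random 8-vertex graphs; 0 failures) are bars of `DomZRelease` itself.  Own work; standard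
axioms.
-/

namespace Summit.Ventures.PercRepro2

namespace TB14DomZFree

open CovForm A3InactiveTyped TB14Fold TB14FlipFamily TB14Hall TB14DomZ

section Keep

variable {V : Type} {E : Type}
variable (ends : E → Sym2 V) (a₁ a₂ o : V)

/-- A released vertex lies in the red cluster of `a₂` of the source. -/
lemma conn_a2_of_released {y y' : Config E} {v : V} (h : Released ends a₂ y y' v) :
    Conn ends y a₂ v :=
  h.1

/-- **A release move keeps the red connections of `a₁`.** Under `a₁ ↮ a₂` in the red copy, every
vertex red-joined to `a₁` is outside the red cluster of `a₂`, hence outside the released part, and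
the move does not touch the edges of a red path from `a₁`. -/
lemma conn_a1_of_release {y y' : Config E} (hq : ¬ Conn ends y a₁ a₂)
    (h : IsReleaseMove ends a₂ o y y') {v : V} (hv : Conn ends y a₁ v) :
    Conn ends y' a₁ v := by
  have key : v ∈ {x : V | Conn ends y a₁ x ∧ Conn ends y' a₁ x} := by
    refine mem_of_conn_of_closed (ends := ends) (ω := y) ?_
      ⟨conn_refl ends _ a₁, conn_refl ends _ a₁⟩ hv
    intro x hx z hxz
    obtain ⟨_, e, he, hends⟩ := openGraph_adj.1 hxz
    have hz : Conn ends y a₁ z := conn_trans hx.1 (conn_of_openAdj ⟨e, he, hends⟩)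
    refine ⟨hz, ?_⟩
    -- neither end of `e` is released: both are red-joined to `a₁`, hence not to `a₂`
    have hoff : y' e = y e := by
      refine h.off e ?_
      intro w hw hrel
      have hw' : w = x ∨ w = z := by
        rw [hends] at hw
        exact Sym2.mem_iff.1 hw
      have hconn : Conn ends y a₁ w := by
        rcases hw' with rfl | rfl
        · exact hx.1
        · exact hz
      exact hq (conn_trans hconn (conn_symm (conn_a2_of_released ends a₂ hrel)))
    have he' : y' e = true := by rw [hoff]; exact he
    exact conn_trans hx.2 (conn_of_openAdj ⟨e, he', hends⟩)
  exact key.2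

end Keep

section Hall

variable {V : Type} {E : Type} [Fintype E] [DecidableEq E]
variable (ends : E → Sym2 V) (a₁ a₂ b o : V) (F : Finset E)

omit [Fintype E] in
/-- A source for the mark `b` is a source for the mark `a₁` (the mark-free form). -/
lemma isSrc_free_of_isSrc {y : Config E} (hs : IsSrc ends a₁ a₂ b o F y) :
    IsSrc ends a₁ a₂ a₁ o F y :=
  ⟨hs.q₁, hs.q₂, conn_refl ends _ a₁, hs.ho, hs.ho'⟩

omit [Fintype E] in
/-- A mark-free target that is a release move of a source for the mark `b` is a target for `b`. -/
lemma isTgt_of_release {y y' : Config E} (hs : IsSrc ends a₁ a₂ b o F y)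
    (ht : IsTgt ends a₁ a₂ a₁ o F y') (hm : IsReleaseMove ends a₂ o y y') :
    IsTgt ends a₁ a₂ b o F y' :=
  ⟨ht.q₁, ht.q₂, conn_a1_of_release ends a₁ a₂ o hs.q₁ hm hs.hb, ht.ho, ht.ho'⟩

open Classical in
/-- The sources for `b` are among the mark-free sources. -/
lemma srcSet_subset_free (z : Config E) :
    srcSet ends a₁ a₂ b o F z ⊆ srcSet ends a₁ a₂ a₁ o F z := by
  intro y hy
  rw [srcSet, Finset.mem_filter] at hy ⊢
  exact ⟨hy.1, hy.2.1, isSrc_free_of_isSrc ends a₁ a₂ b o F hy.2.2⟩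

open Classical in
/-- A mark-free release move of a source for `b` is a release move for `b`. -/
lemma mem_releaseMoves_of_free {y y' : Config E} (hs : IsSrc ends a₁ a₂ b o F y)
    (hy' : y' ∈ releaseMoves ends a₁ a₂ a₁ o F y) : y' ∈ releaseMoves ends a₁ a₂ b o F y := by
  rw [releaseMoves, Finset.mem_filter] at hy' ⊢
  exact ⟨hy'.1, isTgt_of_release ends a₁ a₂ b o F hs hy'.2.1 hy'.2.2, hy'.2.2⟩

open Classical in
/-- **Hall for the mark-free release moves gives Hall for every mark.** -/
theorem releaseHallAt_of_free (z : Config E) (h : ReleaseHallAt ends a₁ a₂ a₁ o F z) :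
    ReleaseHallAt ends a₁ a₂ b o F z := by
  -- a perfect matching of the mark-free sources
  set Src := srcSet ends a₁ a₂ a₁ o F z with hSrc
  have hhall' : ∀ s : Finset {y // y ∈ Src},
      s.card ≤ (s.biUnion fun y => releaseMoves ends a₁ a₂ a₁ o F y.1).card := by
    intro s
    have hsub : s.image Subtype.val ⊆ Src := by
      intro y hy
      obtain ⟨⟨y', hy'⟩, -, rfl⟩ := Finset.mem_image.1 hy
      exact hy'
    have := h _ hsub
    rwa [Finset.card_image_of_injective s Subtype.val_injective, Finset.image_biUnion] at this
  obtain ⟨f, hfinj, hfmem⟩ := (Finset.all_card_le_biUnion_card_iff_exists_injective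
    (fun y : {y // y ∈ Src} => releaseMoves ends a₁ a₂ a₁ o F y.1)).1 hhall'
  -- restrict it to the sources for `b`
  intro S hS
  have hS' : ∀ y ∈ S, y ∈ Src := fun y hy => srcSet_subset_free ends a₁ a₂ b o F z (hS hy)
  let g : Config E → Config E := fun y => if hy : y ∈ Src then f ⟨y, hy⟩ else y
  refine Finset.card_le_card_of_injOn g ?_ ?_
  · intro y hy
    rw [Finset.mem_coe] at hy ⊢
    have hyS : y ∈ Src := hS' y hy
    have hsrc : IsSrc ends a₁ a₂ b o F y := by
      have := hS hy
      rw [srcSet, Finset.mem_filter] at this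
      exact this.2.2
    rw [Finset.mem_biUnion]
    refine ⟨y, hy, ?_⟩
    show (if hy : y ∈ Src then f ⟨y, hy⟩ else y) ∈ releaseMoves ends a₁ a₂ b o F y
    rw [dif_pos hyS]
    exact mem_releaseMoves_of_free ends a₁ a₂ b o F hsrc (hfmem ⟨y, hyS⟩)
  · intro y hy y' hy' hgy
    have hyS : y ∈ Src := hS' y (Finset.mem_coe.1 hy)
    have hyS' : y' ∈ Src := hS' y' (Finset.mem_coe.1 hy')
    have : f ⟨y, hyS⟩ = f ⟨y', hyS'⟩ := by
      have h1 : g y = f ⟨y, hyS⟩ := by simp only [g, dif_pos hyS]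
      have h2 : g y' = f ⟨y', hyS'⟩ := by simp only [g, dif_pos hyS']
      rw [← h1, ← h2]
      exact hgy
    have := hfinj this
    exact congrArg Subtype.val this

end Hall

/-- **The mark-free release Hall** (a Prop, NOT a theorem): on every finite multigraph, for every
roots `a₁ a₂` and bearer `o`, Hall's condition holds for the release moves of the mark-free sources
(`b = a₁`) at the all-free profile — the statement the census codes compute. -/
def DomZReleaseFree : Prop :=
  ∀ (V E : Type) [Fintype E] [DecidableEq E] (ends : E → Sym2 V) (a₁ a₂ o : V),
    ReleaseHallAt ends a₁ a₂ a₁ o Finset.univ (fun _ => false)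

/-- The mark-free form gives the Prop of record. -/
theorem DomZRelease_of_free (h : DomZReleaseFree) : DomZRelease :=
  fun V E _ _ ends a₁ a₂ b o =>
    releaseHallAt_of_free ends a₁ a₂ b o Finset.univ (fun _ => false) (h V E ends a₁ a₂ o)

/-- The Prop of record gives its mark-free form (the case `b = a₁`). -/
theorem free_of_DomZRelease (h : DomZRelease) : DomZReleaseFree :=
  fun V E _ _ ends a₁ a₂ o => h V E ends a₁ a₂ a₁ o

/-- **Row 2′TB follows from the mark-free release Hall** at every profile. -/
theorem TB14_of_DomZReleaseFree (R : Type*) [Field R] [LinearOrder R] [IsStrictOrderedRing R]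
    (h : DomZReleaseFree) : TB14 R :=
  TB14_of_DomZRelease R (DomZRelease_of_free h)

end TB14DomZFree

end Summit.Ventures.PercRepro2
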